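import Summits.BirchSwinnertonDyer.BirchSwinnertonDyer.Theorems.PrintX9MuPartOfPrintKSClosed
import Summits.BirchSwinnertonDyer.BirchSwinnertonDyer.Theorems.PrintX9MuPartStubAKSLinkOfPrint
import Summits.BirchSwinnertonDyer.BirchSwinnertonDyer.Theorems.PrintX9MuPartStabilizedOfSpecWitnesses
import Literature.NumberTheory.EllipticCurves.HeegnerStabilizedClassOfCoherentPairProofs
import Literature.NumberTheory.EllipticCurves.HeegnerCharIdealScalingTransferProofs
import HarnessLib

/-!
# The `Λ`-adic stabilised class `κ_∞` of the COHERENT CGLS datum is non-zero and `𝔖 ⧸ Λκ_∞(C₀)` is torsion —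
# from the print leaf F-411 (CGLS 2022 Thm. 4.1.1 in Kolyvagin-system form) and `Λ`-rank one ONLY; and the
# coherent-pair μ-letter WITH ITS TORSION CLAUSE DERIVED (route-free core; no `Theses` import)

Cell `pub/bsd-print-x9`, seat `bsd-line-x9-p1` (LEAD g7), write-crux stmt-BirchSwinnertonDyer-25235. THEOREMS ONLY (no
definition, no named fact, no `sorry`, no instance); ROUTE-INDEPENDENT (imports no `Theses` file), so that the X9 AND the
X10b pinned closers can consume it.

FINDING. The cite-only leaf `CGLSHeegnerClassNonvanishing` (item 27103; CGLS Thm. 4.1.1 as a `∀ (D, C)` value: `𝔖`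
torsion-free ∧ `Λκ_∞(C) ≠ ⊥` ∧ `𝔖/Λκ_∞(C)` torsion) is consumed by the row-9/row-10 closers ONLY at a COHERENT stabilised datum
`C₀` (the envelope engine's, which comes WITH its class `κ_∞ ∈ 𝔖`: `proj_k κ_∞ = δ(κ_k)` for `k > δ`, `Λκ_∞(C₀) = Λ ∙ κ_∞` —
`exists_coherent_pair_envelope_class`, x9-p2).  There it follows from the OTHER Thm-4.1.1 leaf already among the `closes`
binders, F-411 = `CastellaGrossiLeeSkinner2022.thm411_exists_kolyvaginSystem_one_ne_zero` (`CGLSHeegnerKolyvaginSystem`): for every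
`(D, C, z)` with `proj_k z = δ(κ_k(C))` it yields a Kolyvagin system with `κ.one ≠ 0` on the `Λ`-line of `Φ′(z)`, whence `z ≠ 0`
(μ-LEAD g4's `WeierstrassCurve.ne_zero_of_thm411`; its presentation slots are filled below by tree data), and with
`finrank_Λ 𝔖 = 1` (CGS 6.5.2 / CGLS 4.1.3 (i)) and `𝔖` torsion-free (`E(K)[p] = 0`, p645741) the quotient `𝔖 ⧸ Λ ∙ z` is torsion.

WHAT.
* §1 `stabilizedClass_ne_zero_of_kolyvaginSystemLeaf` (F-411 ⟹ `z ≠ 0`, ANY `C`, any such `z`);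
  `torsionFree_and_isTorsion_quotient_of_kolyvaginSystemLeaf` (+ `Λκ_∞(C) = Λ ∙ z`, `Module.Finite`, `finrank = 1` ⟹ `𝔖`
  torsion-free ∧ `𝔖 ⧸ Λκ_∞(C)` torsion) — conjuncts (1) and (3) of the leaf 27103 at such `C`.
* §2 **`exists_coherentPair_isTorsion_muIneq_of_howard_kolyvaginSystem`** — the coherent-pair μ-letter L∃
  (`HeegnerMuPartStabilized.MuPartStabilizedCoherentPair`, binder prefix verbatim) STRENGTHENED: GIVEN F-161 (Howard Thm. 1.6.1)
  and F-411, on every μ-frame there are the engine's `C`, `F` on `(Dt, β)` with both module-level envelopes AND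
  (`Module.Finite 𝔖 → finrank 𝔖 = 1 → 𝔖 torsion-free ∧ 𝔖/Λκ_∞(C) torsion`) AND (`Module.Finite 𝔖 → Module.Finite 𝒳 →
  finrank 𝔖 = 1 → μ-inequality at (p)`) — the TORSION premiss of L∃ replaced by RANK ONE.  Proof: engine-with-class; §1;
  the landed KS-port `HeegnerMuPartOfPrintKS.portCyclic_of_ks` fed with F-161/F-411 and the kernel letters
  `HeegnerMuPartOfPrintKSClosed.howardInputs_holds` / `controlGlueKS_holds` / `HeegnerMuPartControlGlue.kummerStrictOnFrames_holds`
  (CG-FRAME, 2026-08-29); `HeegnerMuPartStabilized.lengthAt_torsion_le_two_mul_of_hasSpecWitnesses`.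
  `muPartStabilizedCoherentPair_of_howard_kolyvaginSystem` recovers L∃ itself (= p686226's conclusion; sanity twin).
CONSUMERS: `Theorems/PrintX9HowardContainmentOfKolyvaginSystemLeaf.lean` (X9: A^pin 26356 / crux 27077 / aside 25235 without
`hNV`); the X10b twin is the same re-plumbing of `PrintX10bHowardContainmentLightFrameX10bOfMuCoherentPair` (x10b seats).
HONEST FRAMING: CONDITIONAL on the leaves F-161 / F-411 (statement-only Literature facts); nothing asserted about them;
«beyond-print theorem»: no. No summit statement is proved; BSD is NOT proved by any of this.

References: [CastellaGrossiLeeSkinner2022] Thm. 4.1.1, Rem. 4.1.4 (last sentence), §3.3; [Howard2004HeegnerKolyvagin] Thm. 1.6.1,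
§1.3 (H.4/H.5(a)), proof of Thm. 2.2.10; [CastellaGrossiSkinner2025] Thm. 6.5.2 (rank one); [PerrinRiou1987BSMF] §1 p. 405.
-/

set_option linter.dupNamespace false
set_option autoImplicit false

noncomputable section

open scoped Classical Pointwise NumberField
open Field IsDedekindDomain
open Literature Literature.NumberTheory.EllipticCurves WeierstrassCurve
  Literature.NumberTheory.EllipticCurves.ModularForms
  Literature.NumberTheory.EllipticCurves.CastellaGrossiLeeSkinner2022
  Literature.NumberTheory.GaloisCohomology.Howard2004 Literature.NumberTheory.GaloisRepresentations
open Summit.BirchSwinnertonDyer.BirchSwinnertonDyer.Theorems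

namespace Summit.BirchSwinnertonDyer.BirchSwinnertonDyer.Theorems.HeegnerStabilizedOfKSLeaf

/-! ## §1 `κ_∞ ≠ 0` and the torsion of `𝔖 ⧸ Λκ_∞(C)` from F-411 and rank one -/

/-- **`z = κ_∞ ≠ 0` from CGLS 2022 Thm. 4.1.1 in Kolyvagin-system form (F-411) ALONE**, for every stabilised Heegner
datum `C` and every `z ∈ 𝔖` whose projections above the torsion depth are CGLS's level classes `δ(κ_k(C))`: the tree's
`WeierstrassCurve.ne_zero_of_thm411` with its presentation slots filled by tree data (tame pins `nonempty_tamePin`, the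
conjugation datum of the imaginary quadratic `K` lifted from a complex conjugation of `Γ_ℚ`, the source H.4 duality data of the
Shapiro tower `shapiroDualityDataUnitTwist`).
[cite: CastellaGrossiLeeSkinner2022, Thm. 4.1.1 and Rem. 4.1.4 (last sentence: κ_∞ and κ₁^{Hg} generate the same Λ-submodule)]
[cite: Howard2004HeegnerKolyvagin, §1.3 (H.4, H.5(a)) and Def. 1.2.3] -/
theorem stabilizedClass_ne_zero_of_kolyvaginSystemLeaf
    {N : ℕ} [NeZero N] {W : WeierstrassCurve ℚ} [W.IsGloballyMinimal] {K : Type} [Field K] [NumberField K]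
    {p : ℕ} [Fact p.Prime] {κ : ZpExtension K p} {γ : Field.absoluteGaloisGroup K}
    (hKS : thm411_exists_kolyvaginSystem_one_ne_zero) (hyp : Thm413Hypotheses N W K p κ γ)
    (jbar : AlgebraicClosure K →+* ℂ) (D : (W.baseChange K).LambdaAdicSelmerData κ γ)
    (C : StabilizedHeegnerData N W K κ jbar) {z : D.S}
    (hz : ∀ (k : ℕ) (hk : C.depth < k), D.proj k z ∈ stabilizedClassLayer C k hk) : z ≠ 0 := by
  haveI : W.IsElliptic := hyp.isElliptic
  have hK : IsImaginaryQuadratic K := hyp.isImaginaryQuadratic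
  haveI : NumberField.IsTotallyComplex K := hK.isTotallyComplex
  have himag : ∀ w : NumberField.InfinitePlace K, w.IsComplex := fun w ↦ NumberField.IsTotallyComplex.isComplex w
  obtain ⟨c₀, hc₀⟩ := exists_isComplexConjugation (Rat.castHom ℝ)
  obtain ⟨σ, hσ₁, hσ, hτl, hτ₂, -, hτ⟩ := exists_conjugationDatum_ofLifts_τ_eq_absGaloisTransport hK hc₀
  exact W.ne_zero_of_thm411 κ hKS hyp jbar D C z hz (fun v ↦ (nonempty_tamePin v).some)
    (ConjugationDatum.ofLifts σ hσ₁ hσ _ hτl hτ₂)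
    (W.shapiroDualityDataUnitTwist _ κ (-1) hyp.anticyclotomic himag hc₀ hτ)

/-- **Conjuncts (1) and (3) of the leaf `CGLSHeegnerClassNonvanishing` AT a datum `C` carrying the class `κ_∞`**, from
F-411 and `Λ`-rank one: `𝔖` is torsion-free (`E(K)[p] = 0`: `LambdaAdicSelmerData.noZeroSMulDivisors_of_noPTorsion`) and
`𝔖 ⧸ Λκ_∞(C) = 𝔖 ⧸ Λ ∙ κ_∞` is `Λ`-torsion (`κ_∞ ≠ 0` by F-411, no `Λ`-torsion, rank–nullity
`Module.isTorsion_quotient_span_singleton_of_torsionFree_of_finrank_eq_one`).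
[cite: CastellaGrossiLeeSkinner2022, Thm. 4.1.1, Rem. 4.1.4, §3.3] [cite: PerrinRiou1987BSMF, §1 p. 405] -/
theorem torsionFree_and_isTorsion_quotient_of_kolyvaginSystemLeaf
    {N : ℕ} [NeZero N] {W : WeierstrassCurve ℚ} [W.IsGloballyMinimal] {K : Type} [Field K] [NumberField K]
    {p : ℕ} [Fact p.Prime] {κ : ZpExtension K p} {γ : Field.absoluteGaloisGroup K}
    (hKS : thm411_exists_kolyvaginSystem_one_ne_zero) (hyp : Thm413Hypotheses N W K p κ γ)
    (jbar : AlgebraicClosure K →+* ℂ) (D : (W.baseChange K).LambdaAdicSelmerData κ γ)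
    (C : StabilizedHeegnerData N W K κ jbar) {z : D.S}
    (hz : ∀ (k : ℕ) (hk : C.depth < k), D.proj k z ∈ stabilizedClassLayer C k hk)
    (hcyc : stabilizedHeegnerModule D C = Submodule.span (IwasawaAlgebra p) {z})
    [Module.Finite (IwasawaAlgebra p) D.S] (h1 : Module.finrank (IwasawaAlgebra p) D.S = 1) :
    NoZeroSMulDivisors (IwasawaAlgebra p) D.S ∧
      Module.IsTorsion (IwasawaAlgebra p) (D.S ⧸ stabilizedHeegnerModule D C) := by
  haveI : W.IsElliptic := hyp.isElliptic
  have hz0 : z ≠ 0 := stabilizedClass_ne_zero_of_kolyvaginSystemLeaf hKS hyp jbar D C hz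
  refine ⟨D.noZeroSMulDivisors_of_noPTorsion hyp.topGenerator hyp.noPTorsion, ?_⟩
  have hzt : ∀ b : IwasawaAlgebra p, b • z = 0 → b = 0 := fun b hb ↦
    by_contra fun hb0 ↦ D.forall_smul_ne_zero_of_ne_zero' hyp.topGenerator hyp.noPTorsion hz0 b hb0 hb
  rw [hcyc]
  exact Module.isTorsion_quotient_span_singleton_of_torsionFree_of_finrank_eq_one (p := p) h1 hzt

/-! ## §2 The coherent-pair μ-letter with its torsion clause DERIVED (F-161, F-411, rank one) -/

/-- **The coherent-pair μ-letter L∃ strengthened: torsion DERIVED from rank one.**  GIVEN Howard 2004 Thm. 1.6.1 (F-161) and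
CGLS 2022 Thm. 4.1.1 (F-411, Kolyvagin-system form) BY NAME, on every μ-frame (binder prefix of
`HeegnerMuPartStabilized.MuPartStabilizedCoherentPair` verbatim: `Thm413Hypotheses`, `¬CM`, irreducibility over `ℚ` and `K`,
scalar image, (Heeg) for `p`, `p ∣ h_K`, `p ∤ N`, the sharp tower, `[K[p] : K[1]] = p − 1`, a parametrisation `Dt` and an
orientation `β`, Selmer data `D`, `X`) THERE ARE a stabilised datum `C` and a Howard family `F` on `(Dt, β)` with
`ℋ_∞(F) ≤ Λκ_∞(C)`, `g • Λκ_∞(C) ≤ ℋ_∞(F)` (`g ≠ 0`), such that `Λ`-RANK ONE of `𝔖` gives `𝔖` torsion-free and `𝔖/Λκ_∞(C)` torsion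
(§1 at the engine's class `κ_∞`), and rank one + finiteness of `𝔖`, `𝒳` give the μ-inequality
`length_(p)(𝒳_tors) ≤ 2·length_(p)(𝔖/Λκ_∞(C))` (the landed KS-port `HeegnerMuPartOfPrintKS.portCyclic_of_ks` at `(D, C, X, κ_∞)` with
the kernel letters of CG-FRAME, then `lengthAt_torsion_le_two_mul_of_hasSpecWitnesses`).  CONDITIONAL on the two leaves.
[cite: Howard2004HeegnerKolyvagin, Thm. 1.6.1 and proof of Thm. 2.2.10 (𝔮 = T^m + p)]
[cite: CastellaGrossiLeeSkinner2022, Thm. 4.1.1 and Rem. 4.1.4] [cite: PerrinRiou1987BSMF, §3.4 Prop. 10] -/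
theorem exists_coherentPair_isTorsion_muIneq_of_howard_kolyvaginSystem
    (h161 : thm161_dvrKolyvaginBound) (hKS : thm411_exists_kolyvaginSystem_one_ne_zero) :
    ∀ (N : ℕ) [NeZero N] (W : WeierstrassCurve ℚ) [W.IsGloballyMinimal] (K : Type) [Field K] [NumberField K]
      (p : ℕ) [Fact p.Prime] (κ : ZpExtension K p) (γ : Field.absoluteGaloisGroup K)
      (jbar : AlgebraicClosure K →+* ℂ),
      Thm413Hypotheses N W K p κ γ →
      ¬ W.HasCM → W.HasIrreducibleModPGaloisRep p → (W.baseChange K).HasIrreducibleModPGaloisRep p →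
      MastellaZerman2026.HasPadicScalarImage W p → SatisfiesHeegnerHypothesis p K →
      p ∣ NumberField.classNumber K →
      ¬ p ∣ N →
      (∀ k, ringClassSubgroup K (p ^ (k + 1)) jbar ≤ κ.layerSubgroup k) →
      Nat.card (ringClassGalOver (jbar.comp (algebraMap K (AlgebraicClosure K))) p 1) = p - 1 →
      ∀ (Dt : ModularParametrizationData W N) (β : ℤ), (4 * N : ℤ) ∣ β ^ 2 - NumberField.discr K →
      ∀ (D : (W.baseChange K).LambdaAdicSelmerData κ γ) (X : (W.baseChange K).SelmerDualData κ γ),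
      ∃ (C : StabilizedHeegnerData N W K κ jbar) (F : HeegnerFamily N W K κ jbar),
        C.Dt = Dt ∧ F.Dt = Dt ∧ C.β = β ∧ F.β = β ∧
        heegnerModule D F ≤ stabilizedHeegnerModule D C ∧
        (∃ g : IwasawaAlgebra p, g ≠ 0 ∧ g • stabilizedHeegnerModule D C ≤ heegnerModule D F) ∧
        (Module.Finite (IwasawaAlgebra p) D.S → Module.finrank (IwasawaAlgebra p) D.S = 1 →
          NoZeroSMulDivisors (IwasawaAlgebra p) D.S ∧
            Module.IsTorsion (IwasawaAlgebra p) (D.S ⧸ stabilizedHeegnerModule D C)) ∧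
        (Module.Finite (IwasawaAlgebra p) D.S → Module.Finite (IwasawaAlgebra p) X.X →
          Module.finrank (IwasawaAlgebra p) D.S = 1 →
          ∀ 𝔭 : PrimeSpectrum (IwasawaAlgebra p), 𝔭.asIdeal = Ideal.span {(p : IwasawaAlgebra p)} →
            Module.lengthAt (IwasawaAlgebra p) (Submodule.torsion (IwasawaAlgebra p) X.X) 𝔭 ≤
              2 * Module.lengthAt (IwasawaAlgebra p) (D.S ⧸ stabilizedHeegnerModule D C) 𝔭) := by
  intro N _ W _ K _ _ p _ κ γ jbar hyp hCM hirr hirrK hsc hHp hhK hpN hTw1 hcardp Dt β hβ D X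
  have hlev : N = W.conductorNorm ℤ := hyp.level
  subst hlev
  haveI : W.IsElliptic := hyp.isElliptic
  -- the engine's coherent pair `(C, F)` on `(Dt, β)` WITH its class `z = κ_∞`
  obtain ⟨C, F, hCDt, hFDt, hCβ, hFβ, hfwd, hrev, z, hz, hcyc⟩ :=
    exists_coherent_pair_envelope_class (W := W) hyp.isImaginaryQuadratic hyp.heegner Dt hβ jbar hyp.ordinary hpN κ
      hyp.topGenerator hTw1 hcardp hyp.noPTorsion D
  refine ⟨C, F, hCDt, hFDt, hCβ, hFβ, hfwd, hrev, fun hfinS hS1 ↦ ?_, fun hfinS hfinX hS1 𝔭 h𝔭 ↦ ?_⟩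
  · haveI := hfinS
    exact torsionFree_and_isTorsion_quotient_of_kolyvaginSystemLeaf hKS hyp jbar D C hz hcyc hS1
  · haveI := hfinS
    haveI := hfinX
    obtain ⟨-, htorC⟩ := torsionFree_and_isTorsion_quotient_of_kolyvaginSystemLeaf hKS hyp jbar D C hz hcyc hS1
    -- the specialised witnesses at `(D, C, X, κ_∞)` from the landed KS-port and the kernel letters of CG-FRAME
    have hW := HeegnerMuPartOfPrintKS.portCyclic_of_ks h161 hKS HeegnerMuPartControlGlue.kummerStrictOnFrames_holds
      HeegnerMuPartOfPrintKSClosed.howardInputs_holds HeegnerMuPartOfPrintKSClosed.controlGlueKS_holds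
      (W.conductorNorm ℤ) W K p κ γ jbar hyp hCM hirr hirrK hsc hHp hhK D C X z hz hcyc hfinS hfinX htorC
    exact HeegnerMuPartStabilized.lengthAt_torsion_le_two_mul_of_hasSpecWitnesses p _ htorC hW 𝔭 h𝔭

/-- **Sanity twin: the L∃ letter `HeegnerMuPartStabilized.MuPartStabilizedCoherentPair` itself from F-161 and F-411** (same
conclusion as LEAD g6's p686226 `muPartStabilizedCoherentPair_of_thm161_thm411`, obtained here from §2 by dropping the torsion
premiss the letter carries — the letter asks for torsion, §2 asks for nothing it cannot derive, so we feed the letter's own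
torsion hypothesis straight to the KS-port). [cite: Howard2004HeegnerKolyvagin, Thm. 1.6.1] [cite: CastellaGrossiLeeSkinner2022, Thm. 4.1.1] -/
theorem muPartStabilizedCoherentPair_of_howard_kolyvaginSystem
    (h161 : thm161_dvrKolyvaginBound) (hKS : thm411_exists_kolyvaginSystem_one_ne_zero) :
    HeegnerMuPartStabilized.MuPartStabilizedCoherentPair :=
  HeegnerMuPartOfPrintKS.muPartStabilizedCoherentPair_of_thm161_thm411_ks HeegnerMuPartOfPrintKSClosed.howardInputs_holds
    HeegnerMuPartOfPrintKSClosed.controlGlueKS_holds h161 hKS HeegnerMuPartControlGlue.kummerStrictOnFrames_holds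

end Summit.BirchSwinnertonDyer.BirchSwinnertonDyer.Theorems.HeegnerStabilizedOfKSLeaf

end
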